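import Literature.NumberTheory.GaloisRepresentations.GalLayerSystemLayers
import HarnessLib

/-!
# Morphisms of Galois layer systems and their limits: equivariant maps `lim D → lim D'` in `C_Γ`, and exactness
# passes to the limit (Tate, C–F VII §9.7, §11.1; Serre, *Galois Cohomology* I §2.2)

Topic `NumberTheory/GaloisRepresentations`; namespace `Literature.NumberTheory.GaloisRepresentations.GalLayerData`
(structure `GalLayerData.Hom`).  Sequel to `GalLayerSystemLayers.lean` (door-c5 g16: `GalLayerData F`, `D.toSystem`,
`D.toSystem.limit`, `.of`, `.rep`, `.toD : DiscreteRepCat ℤ Γ_F`).  Definitions with bodies and theorems; NO named fact,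
no `sorry`, no instance, no notation.  Route A of crux `AnticycControlAdditiveK` (item 19295): the maps `F̄ˣ → J̄ → C̄` and the
short exactness of `0 → F̄ˣ → J̄ → C̄ → 0` in `C_Γ` (sequel `GalLayerSystemSES.lean`) are instances of this file.

Mathematics.  A morphism of systems `φ : D → D'` is a family of `Gal(E/F)`-equivariant additive maps
`φ_E : D.V E → D'.V E` commuting with the base changes.  It induces an additive, `Γ_F`-equivariant map of the direct limits
`lim→ φ_E : lim D → lim D'` (Mathlib `AddCommGroup.DirectLimit.map`), i.e. a morphism in `C_Γ`; on the layer `E` it is `φ_E`.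
Directed colimits of abelian groups are exact: if every `0 → D.V E → D'.V E → D''.V E → 0` is exact (elementwise: `φ_E`
injective, `ψ_E` onto, `ker ψ_E = im φ_E`) then so is `0 → lim D → lim D' → lim D'' → 0` — each element of a limit lives
in some layer (`exists_of`) and the layer maps into the limit are injective (`of_injective`) — and the sequence is short
exact in the abelian category `C_Γ` (monos/epis/exactness are reflected by the faithful exact inclusion into `Rep ℤ Γ_F`
and the forgetful functor to `ℤ`-modules, as in door-c4's `DiscreteRepLayerColimitSetup`).

## What is formalised (`F : Type` a number field, `Γ = absoluteGaloisGroup F`, `D D' D'' : GalLayerData F`)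

* §7 **`GalLayerData.Hom D D'`** (`app`, `app_ρ`, `base_app`), `Hom.comp`, `φ.appRepHom E : D.obj E ⟶ D'.obj E`.
* §8 **`φ.limitMap : lim D →+ lim D'`** (+ `limitMap_of`, **`limitMap_rep`** equivariance, `limitMap_comp`),
  **`φ.limitRepHom`**, **`φ.limitHom : D.toSystem.toD ⟶ D'.toSystem.toD`** (in `C_Γ`; `limitHom_hom`, `ι_map_limitHom`).
* §9 exactness in the limit: **`limitMap_injective`**, **`limitMap_surjective`**, **`exists_limitMap_eq_of_limitMap_eq_zero`**,
  `limitMap_limitMap_eq_zero`; **`limitShortComplex`** and **`limitShortComplex_shortExact`** (short exact in `C_Γ`).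

## References
* J. W. S. Cassels, A. Fröhlich (eds.), *Algebraic Number Theory* (1967), Ch. VII (J. Tate) §9.7, §11.1.
  [CasselsFrohlichANT1967]
* J.-P. Serre, *Galois Cohomology*, Springer (1997), I §2.2. [SerreGaloisCohomology1997]
-/

noncomputable section

open CategoryTheory CategoryTheory.Limits Representation
open Field (absoluteGaloisGroup)
open Literature.Algebra.Homology
open scoped Classical

universe u

namespace Literature.NumberTheory.GaloisRepresentations

open IdeleClassBar

/-- A short complex of representations whose second map kills exactly the image of the first (elementwise) is exact
(exactness is reflected from `k`-modules by the faithful forgetful functor; stated universe-polymorphically so that the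
forgetful functor is elaborated once here, cf. the same device in `IdeleGaloisRep.lean`). [folklore] -/
private theorem repShortComplex_exact_of_apply {k G : Type u} [CommRing k] [Group G] (S : ShortComplex (Rep.{u} k G))
    (hex : ∀ x, S.g.hom x = 0 → ∃ y, S.f.hom y = x) : S.Exact := by
  apply (forget₂ (Rep k G) (ModuleCat k)).reflects_exact_of_faithful
  rw [ShortComplex.moduleCat_exact_iff]
  exact hex

namespace GalLayerData

variable {F : Type} [Field F]

/-! ## §7. Morphisms of systems -/

/-- **A morphism of Galois layer systems**: `Gal(E/F)`-equivariant additive maps of the layers commuting with the base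
changes. [cite: CasselsFrohlichANT1967, Ch. VII §11.1] -/
structure Hom (D D' : GalLayerData F) where
  /-- The map on the layer `E`. -/
  app (E : GalLayer F) : D.V E →+ D'.V E
  /-- Equivariance for `Gal(E/F)`. -/
  app_ρ (E : GalLayer F) (g : E.1 ≃ₐ[F] E.1) (x : D.V E) : app E (D.ρ E g x) = D'.ρ E g (app E x)
  /-- Compatibility with the base changes. -/
  base_app ⦃E E' : GalLayer F⦄ (h : E ≤ E') (x : D.V E) : D'.base h (app E x) = app E' (D.base h x)

namespace Hom

variable {D D' D'' : GalLayerData F} (φ : Hom D D') (ψ : Hom D' D'')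

/-- Composition of morphisms of systems. [cite: CasselsFrohlichANT1967, Ch. VII §11.1] -/
def comp : Hom D D'' where
  app E := (ψ.app E).comp (φ.app E)
  app_ρ E g x := by
    change ψ.app E (φ.app E (D.ρ E g x)) = D''.ρ E g (ψ.app E (φ.app E x))
    rw [φ.app_ρ, ψ.app_ρ]
  base_app E E' h x := by
    change D''.base h (ψ.app E (φ.app E x)) = ψ.app E' (φ.app E' (D.base h x))
    rw [ψ.base_app, φ.base_app]

/-- Formula for `comp`. [cite: CasselsFrohlichANT1967, Ch. VII §11.1] -/
@[simp] theorem comp_app (E : GalLayer F) (x : D.V E) : (φ.comp ψ).app E x = ψ.app E (φ.app E x) := rfl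

/-- **The layer map as a morphism `D.obj E ⟶ D'.obj E` of `Rep ℤ Gal(E/F)`.** [cite: CasselsFrohlichANT1967, Ch. VII §8] -/
def appRepHom (E : GalLayer F) : D.obj E ⟶ D'.obj E :=
  Rep.ofHom ⟨(φ.app E).toIntLinearMap, fun g => LinearMap.ext fun x => φ.app_ρ E g x⟩

/-- Formula. [cite: CasselsFrohlichANT1967, Ch. VII §8] -/
@[simp] theorem appRepHom_hom_apply (E : GalLayer F) (x : D.V E) : (φ.appRepHom E).hom x = φ.app E x := rfl

/-! ## §8. The induced map of limits -/

/-- **The induced map `lim→ φ_E : lim D →+ lim D'`** (Mathlib `AddCommGroup.DirectLimit.map`).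
[cite: CasselsFrohlichANT1967, Ch. VII §9.7] -/
def limitMap : D.toSystem.limit →+ D'.toSystem.limit :=
  AddCommGroup.DirectLimit.map (fun E => φ.app E) fun _ _ h => AddMonoidHom.ext fun x => (φ.base_app h x).symm

/-- **`(lim φ) [x]_E = [φ_E x]_E`.** [cite: CasselsFrohlichANT1967, Ch. VII §9.7] -/
@[simp] theorem limitMap_of (E : GalLayer F) (x : D.V E) :
    φ.limitMap (D.toSystem.of E x) = D'.toSystem.of E (φ.app E x) := by
  unfold limitMap GalLayerSystem.of
  rw [AddCommGroup.DirectLimit.map_apply_of]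

/-- `lim (ψ ∘ φ) = lim ψ ∘ lim φ`. [cite: CasselsFrohlichANT1967, Ch. VII §9.7] -/
theorem limitMap_comp (z : D.toSystem.limit) : (φ.comp ψ).limitMap z = ψ.limitMap (φ.limitMap z) := by
  obtain ⟨E, x, rfl⟩ := D.toSystem.exists_of z
  rw [limitMap_of, limitMap_of, limitMap_of, comp_app]

/-- **`lim φ` is `Γ_F`-equivariant.** [cite: CasselsFrohlichANT1967, Ch. VII §9.7] -/
theorem limitMap_rep (σ : absoluteGaloisGroup F) (z : D.toSystem.limit) :
    φ.limitMap (D.toSystem.rep σ z) = D'.toSystem.rep σ (φ.limitMap z) := by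
  obtain ⟨E, x, rfl⟩ := D.toSystem.exists_of z
  rw [GalLayerSystem.rep_of, limitMap_of, limitMap_of, GalLayerSystem.rep_of]
  exact congrArg (D'.toSystem.of E) (φ.app_ρ E _ x)

/-- **`lim φ` as a morphism of `Rep ℤ Γ_F`.** [cite: CasselsFrohlichANT1967, Ch. VII §9.7] -/
def limitRepHom : D.toSystem.toRep ⟶ D'.toSystem.toRep :=
  Rep.ofHom ⟨φ.limitMap.toIntLinearMap, fun σ => LinearMap.ext fun z => φ.limitMap_rep σ z⟩

/-- Formula. [cite: CasselsFrohlichANT1967, Ch. VII §9.7] -/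
@[simp] theorem limitRepHom_hom_apply (z : D.toSystem.limit) : φ.limitRepHom.hom z = φ.limitMap z := rfl

/-- **`lim φ` as a morphism of `C_Γ = DiscreteRepCat ℤ Γ_F`.** [cite: CasselsFrohlichANT1967, Ch. VII §9.7] -/
def limitHom : D.toSystem.toD ⟶ D'.toSystem.toD := ObjectProperty.homMk φ.limitRepHom

/-- `(lim φ).hom = limitRepHom`. [cite: CasselsFrohlichANT1967, Ch. VII §9.7] -/
@[simp] theorem limitHom_hom : φ.limitHom.hom = φ.limitRepHom := rfl

/-- The inclusion `C_Γ ⥤ Rep` sends `lim φ` to `limitRepHom`. [cite: CasselsFrohlichANT1967, Ch. VII §9.7] -/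
theorem ι_map_limitHom : (DiscreteRep.ι ℤ (absoluteGaloisGroup F)).map φ.limitHom = φ.limitRepHom := rfl

/-- `lim (ψ ∘ φ) = lim φ ≫ lim ψ` in `C_Γ`. [cite: CasselsFrohlichANT1967, Ch. VII §9.7] -/
theorem limitHom_comp : (φ.comp ψ).limitHom = φ.limitHom ≫ ψ.limitHom :=
  ObjectProperty.hom_ext _ (Rep.hom_ext (Representation.IntertwiningMap.ext
    (LinearMap.ext fun z => φ.limitMap_comp ψ z)))

/-! ## §9. Exactness passes to the limit -/

/-- **If every `φ_E` is injective, `lim φ` is injective.** [cite: SerreGaloisCohomology1997, I §2.2] -/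
theorem limitMap_injective (hφ : ∀ E, Function.Injective (φ.app E)) : Function.Injective φ.limitMap := by
  refine (injective_iff_map_eq_zero _).2 fun z hz => ?_
  obtain ⟨E, x, rfl⟩ := D.toSystem.exists_of z
  rw [limitMap_of] at hz
  have hx : φ.app E x = 0 := D'.toSystem.of_injective E (hz.trans (map_zero _).symm)
  rw [(injective_iff_map_eq_zero _).1 (hφ E) x hx, map_zero]

/-- **If every `φ_E` is surjective, `lim φ` is surjective.** [cite: SerreGaloisCohomology1997, I §2.2] -/
theorem limitMap_surjective (hφ : ∀ E, Function.Surjective (φ.app E)) : Function.Surjective φ.limitMap := by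
  intro z
  obtain ⟨E, y, rfl⟩ := D'.toSystem.exists_of z
  obtain ⟨x, rfl⟩ := hφ E y
  exact ⟨D.toSystem.of E x, φ.limitMap_of E x⟩

/-- `lim ψ ∘ lim φ = 0` if every `ψ_E ∘ φ_E = 0`. [cite: SerreGaloisCohomology1997, I §2.2] -/
theorem limitMap_limitMap_eq_zero (h0 : ∀ E (x : D.V E), ψ.app E (φ.app E x) = 0) (w : D.toSystem.limit) :
    ψ.limitMap (φ.limitMap w) = 0 := by
  obtain ⟨E, x, rfl⟩ := D.toSystem.exists_of w
  rw [limitMap_of, limitMap_of, h0, map_zero]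

/-- **Exactness in the middle passes to the limit**: if `ker ψ_E ⊆ im φ_E` for every layer, then `ker (lim ψ) ⊆ im (lim φ)`.
[cite: SerreGaloisCohomology1997, I §2.2] -/
theorem exists_limitMap_eq_of_limitMap_eq_zero (hex : ∀ E (y : D'.V E), ψ.app E y = 0 → ∃ x, φ.app E x = y)
    (z : D'.toSystem.limit) (hz : ψ.limitMap z = 0) : ∃ w, φ.limitMap w = z := by
  obtain ⟨E, y, rfl⟩ := D'.toSystem.exists_of z
  rw [limitMap_of] at hz
  obtain ⟨x, hx⟩ := hex E y (D''.toSystem.of_injective E (hz.trans (map_zero _).symm))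
  exact ⟨D.toSystem.of E x, by rw [limitMap_of, hx]⟩

/-- **The limit short complex `lim D → lim D' → lim D''` in `C_Γ`** (for `ψ_E ∘ φ_E = 0` layerwise).
[cite: CasselsFrohlichANT1967, Ch. VII §11.1] -/
def limitShortComplex (h0 : ∀ E (x : D.V E), ψ.app E (φ.app E x) = 0) :
    ShortComplex (DiscreteRepCat ℤ (absoluteGaloisGroup F)) :=
  ShortComplex.mk φ.limitHom ψ.limitHom (by
    rw [← limitHom_comp]
    refine ObjectProperty.hom_ext _ (Rep.hom_ext (Representation.IntertwiningMap.ext (LinearMap.ext fun w => ?_)))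
    exact (φ.limitMap_comp ψ w).trans (limitMap_limitMap_eq_zero φ ψ h0 w))

/-- **Directed colimits are exact: if every layer sequence `0 → D.V E → D'.V E → D''.V E → 0` is exact, then
`0 → lim D → lim D' → lim D'' → 0` is short exact in `C_Γ`.**  Monos, epis and exactness are reflected from `ℤ`-modules
through the faithful exact inclusion `C_Γ ⥤ Rep ℤ Γ_F` (door-c4's `DiscreteRepCategory`) and the forgetful functor.
[cite: SerreGaloisCohomology1997, I §2.2][cite: CasselsFrohlichANT1967, Ch. VII §11.1] -/
theorem limitShortComplex_shortExact (h0 : ∀ E (x : D.V E), ψ.app E (φ.app E x) = 0)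
    (hinj : ∀ E, Function.Injective (φ.app E)) (hsurj : ∀ E, Function.Surjective (ψ.app E))
    (hex : ∀ E (y : D'.V E), ψ.app E y = 0 → ∃ x, φ.app E x = y) :
    (limitShortComplex φ ψ h0).ShortExact := by
  haveI : (DiscreteRep.ι ℤ (absoluteGaloisGroup F)).PreservesHomology :=
    ⟨fun _ _ f => (DiscreteRep.isDiscrete ℤ (absoluteGaloisGroup F)).preservesKernels_ι f,
      fun _ _ f => (DiscreteRep.isDiscrete ℤ (absoluteGaloisGroup F)).preservesCokernels_ι f⟩
  refine { exact := ?_, mono_f := ?_, epi_g := ?_ }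
  · rw [← ShortComplex.exact_map_iff_of_faithful _ (DiscreteRep.ι ℤ (absoluteGaloisGroup F))]
    exact repShortComplex_exact_of_apply _ fun z hz => exists_limitMap_eq_of_limitMap_eq_zero φ ψ hex z hz
  · exact (DiscreteRep.ι ℤ (absoluteGaloisGroup F)).mono_of_mono_map
      ((Rep.mono_iff_injective φ.limitRepHom).2 (φ.limitMap_injective hinj))
  · exact (DiscreteRep.ι ℤ (absoluteGaloisGroup F)).epi_of_epi_map
      ((Rep.epi_iff_surjective ψ.limitRepHom).2 (ψ.limitMap_surjective hsurj))

end Hom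

end GalLayerData

end Literature.NumberTheory.GaloisRepresentations

end
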